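import Mathlib.Topology.Algebra.GroupWithZero
import Literature.Probability.RandomPlanarGeometry.PlanarDomains
import Literature.Probability.RandomPlanarGeometry.ChordalCurveFamily
import HarnessLib

/-!
# Crux `PolyominoGaussianLaw`, line `registered`: stub `stub_dilatedCopy`

Bookkeeping stub of the skeleton `Cruxes/PolyominoGaussianLaw/Lines/birth.lean` (v2): the dilate
`t · R` (`t > 0`) of a conformal rectangle `R = (D; a, b, c, d)` is again a conformal rectangle,
with carrier `t · D` and boundary arcs `t · (R.arc i)`.

The construction is the image marked domain `MarkedDomain.map`
(`Literature/Probability/RandomPlanarGeometry/ChordalCurveFamily.lean`, all fields proved) under the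
plane homeomorphism `Homeomorph.mulLeft₀ (t : ℂ)`: same boundary parametrisation scaled by `t`, same
marks; the arc identity is `MarkedDomain.arc_map`.
-/

namespace Summit.CriticalPhenomena.CardyFormulaZ2.Cruxes.PolyominoGaussianLaw.Birth

open Literature.Probability.RandomPlanarGeometry

/-- **Registered stub `stub_dilatedCopy`** of the line `registered` (dilated copies; bookkeeping).
The dilate `t · R`, `t > 0`, of a conformal rectangle is a conformal rectangle: there is `R'` with
carrier `t · Ω` and boundary arcs `t · (R.arc i)` (same boundary parametrisation scaled, same marks),
namely `R' = R.map (Homeomorph.mulLeft₀ t _)`. [folklore] -/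
theorem stub_dilatedCopy :
    ∀ R : Literature.Probability.RandomPlanarGeometry.ConformalRectangle, ∀ t : ℝ, 0 < t →
      ∃ R' : Literature.Probability.RandomPlanarGeometry.ConformalRectangle,
        R'.carrier = (fun z : ℂ => (t : ℂ) * z) '' R.carrier ∧
          ∀ i, R'.arc i = (fun z : ℂ => (t : ℂ) * z) '' R.arc i := by
  intro R t ht
  refine ⟨R.map (Homeomorph.mulLeft₀ (t : ℂ) (Complex.ofReal_ne_zero.2 ht.ne')), rfl, fun i => ?_⟩
  rw [MarkedDomain.arc_map]
  rfl

end Summit.CriticalPhenomena.CardyFormulaZ2.Cruxes.PolyominoGaussianLaw.Birth
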